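import Summits.QuantumFields.YangMills.Theorems.BalabanLadderIRAbstractBasinRung
import Summits.QuantumFields.YangMills.Theorems.DoublingDefectRecursionToGapSpectral
import Literature.MathematicalPhysics.QuantumLattice.GaugeGroupsProofs
import HarnessLib

/-!
# The one-box seed `E(θ) = BasinRung.ColdExitAt θ` is FALSE at every negative tolerance (crux `IR`, stmt-QuantumFields-19354)

Negative-lane CALIBRATION, companion of `Theorems/IR/Negative/ColdExitAtVacuityThreshold.lean` (p610150), by the
typed-kill lineage `ym-19354-disprove-1` (memo `pub/ym-beyond/ym-19354-disprove-1/NOT-REFUTED.md` §23.8), for the stub of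
record `ExitBill24.stub_seed24 : BasinRung.ColdExitAt (1/24)` (slot `Cruxes/IR/Lines/exit_bill_24.lean`):

* `not_coldExitAt_of_neg` — `SimplyConnectedSpace SU(2) → θ < 0 → ¬ ColdExitAt θ`: at the admissible instance `SU(2)`
  (tree: `isCompactSimpleLieGroup_specialUnitaryGroup`) and any `β ≥ max β₁ 0`, trace positivity of the transfer matrix
  gives `0 ≤ δᶜ_β(L)` for `L ≥ 8` (`DoublingDefect.coldDefect_nonneg`: `Σ λ^{2t} ≤ (Σ λ^t)²`), so no cold torus has defect
  `≤ θ < 0`.  The hypothesis `SimplyConnectedSpace SU(2)` is PROVED in the tree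
  (`Theorems.BrascampLiebVacuumSC.Negative.simplyConnectedSpace_su2`, file `Theorems/BrascampLiebVacuumSC/Negative/
  AdmissibleInstance.lean`); it is carried as a hypothesis here only to keep this module outside that file's Theses cone
  (`lint.theses-cone`) — any consumer discharges it in one term.

Together with p610150 (`ColdExitAt θ` trivially TRUE for `θ ≥ 1`): the seed family is decided by kernel facts OUTSIDE
`[0, 1)`; the registered tolerance `1/24` (and every re-base in `(0,1)`) lies in the contentful window, where `¬ E(θ)`
would be β-cofinal non-purity of every cold `4:1` torus of a simply-connected simple group — not a kernel target
(NOT-REFUTED §23.8).  (`θ = 0` is also false — a finite torus has more than one transfer-matrix eigenvalue — but that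
needs a strict trace inequality not in the tree; not claimed.)

HONEST FRAMING: calibration only; nothing here bears on the Yang–Mills mass gap, on `BalabanLadder.IR`, or on `E(1/24)`.
[folklore]
-/

noncomputable section

open Literature.MathematicalPhysics.QuantumFieldTheory
open Summit.QuantumFields.YangMills.Cruxes.IR.ColdPurityBridge (coldDefect)
open Summit.QuantumFields.YangMills.Cruxes.IR.BasinRung (ColdExitAt)

namespace Summit.QuantumFields.YangMills.Cruxes.IR.BasinRung.Negative

/-- **`E(θ)` is false for `θ < 0`** (witness group `SU(2)` — simply connected by the tree's
`BrascampLiebVacuumSC.Negative.simplyConnectedSpace_su2`, taken as a hypothesis to stay outside that module's Theses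
cone —, any lattice representation; `δᶜ ≥ 0` at `β ≥ 0`). [folklore] -/
theorem not_coldExitAt_of_neg (hsc : SimplyConnectedSpace (Matrix.specialUnitaryGroup (Fin 2) ℂ)) {θ : ℝ}
    (hθ : θ < 0) : ¬ ColdExitAt θ := by
  intro h
  have hSU : IsCompactSimpleLieGroup (Matrix.specialUnitaryGroup (Fin 2) ℂ) :=
    isCompactSimpleLieGroup_specialUnitaryGroup
      Literature.MathematicalPhysics.QuantumLattice.isSimpleCompactGroup_specialUnitaryGroup_holds le_rfl
  obtain ⟨r⟩ := hSU.2
  letI : MeasurableSpace (Matrix.specialUnitaryGroup (Fin 2) ℂ) := borel _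
  haveI : BorelSpace (Matrix.specialUnitaryGroup (Fin 2) ℂ) := ⟨rfl⟩
  obtain ⟨β₁, hβ₁⟩ := h (Matrix.specialUnitaryGroup (Fin 2) ℂ) hSU hsc r
  obtain ⟨L, hL, hdef⟩ := hβ₁ (max β₁ 0) (le_max_left _ _)
  haveI : NeZero L := ⟨by omega⟩
  haveI : SecondCountableTopology (Matrix.specialUnitaryGroup (Fin 2) ℂ) :=
    (r.continuous.isClosedEmbedding r.injective).isEmbedding.secondCountableTopology
  have hnn : 0 ≤ coldDefect r.ρ (max β₁ 0) L := by
    unfold coldDefect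
    exact Summit.QuantumFields.YangMills.Theorems.DoublingDefect.coldDefect_nonneg r.continuous r.mem_unitary
      (le_max_right _ _) L (L / 4) (by omega)
  linarith
end Summit.QuantumFields.YangMills.Cruxes.IR.BasinRung.Negative

end
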